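import Literature.AlgebraicGeometry.Resolution.AlterationsNormalizationReduction
import Literature.AlgebraicGeometry.Resolution.AlterationsDimension
import Literature.AlgebraicGeometry.Resolution.QuasiProjectiveResolution
import HarnessLib

/-!
# Surface resolution over a field: reduction of `CossartJannsenSaito2020` to normal integral surfaces

Topic: `Literature/AlgebraicGeometry/Resolution`. The named fact `CossartJannsenSaito2020`
(`ArithmeticalThreefolds.lean`: `∀ k, ResolutionOverUpToDim k 2`, the weak form over fields of
Cossart–Jannsen–Saito 2020, Thm. 1.2 — resolution of reduced excellent Noetherian schemes of
dimension `≤ 2`) is NOT proved in this tree: its content is the resolution of singularities of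
surfaces over an arbitrary field (Zariski 1939, Abhyankar 1956/1969, Lipman 1978,
Cossart–Jannsen–Saito 2020), a theory of its own (Hilbert–Samuel strata, permissible blow-ups,
characteristic polyhedra; LNM 2270, Chs. 2–14). In the tree it is a one-line corollary of the
two unproved named facts `CossartJannsenSaito2020General` (Thm. 1.2 as printed) and
`Stacks07QW_field` (`CossartJannsenSaito2020General.cossartJannsenSaito2020`,
`QuasiExcellentSchemes.lean`).

This file records, PROVED, how far the tree's unconditional results already cut the statement
down — the classical first step of the proofs of surface resolution that start by normalizing
(Zariski 1939; Lipman 1978: normalize, blow up the finitely many singular points, repeat):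
`CossartJannsenSaito2020` follows from the resolution of
**normal integral surfaces of dimension exactly `2`** of finite type over a field. Ingredients,
all proved elsewhere in the topic: reduced curves are resolved by normalization
(`hasResolution_of_dim_le_one`, `ResolutionOfCurves.lean`); resolution of a reduced scheme
reduces to its integral components (`IntegralResolutionOverUpToDim.resolutionOverUpToDim`,
`ResolutionOfComponents.lean`); the normalization `X^ν → X` of a variety is finite
(E. Noether, `NoetherFiniteIntegralClosure_holds`), an isomorphism over a dense open, normal
(`isIntegrallyClosed_stalk_normalization`) and of the same dimension
(`IsAlteration.topologicalKrullDim_eq`); proper birational morphisms transport resolutions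
(`Scheme.HasResolution.of_isBirational`, `QuasiProjectiveResolution.lean`).

## Content

* `le_one_or_eq_two_of_le_two` — arithmetic of `topologicalKrullDim`: `d ≤ 2 ⇒ d ≤ 1 ∨ d = 2`.
* `isBirational_normalizationι` — the normalization of an integral scheme locally of finite type
  over a field is birational (an isomorphism over a non-empty normal affine open).
* `Scheme.HasResolution.of_normalization` — a resolution of `X^ν` gives one of `X`;
  `topologicalKrullDim_normalization` — `dim X^ν = dim X`.
* `resolutionOverUpToDim_two_of_normalSurfaces` — the reduction: over `k`, if every normal
  integral separated `k`-scheme of finite type of dimension exactly `2` has a resolution, then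
  `ResolutionOverUpToDim k 2`; `resolutionOverUpToDim_two_iff_normalSurfaces`;
  `cossartJannsenSaito2020_of_normalSurfaces`, `cossartJannsenSaito2020_iff_normalSurfaces`.
  The residual hypothesis is written out as a `∀`-statement (no new named fact is introduced).

## Sources

* V. Cossart, U. Jannsen, S. Saito, *Desingularization: Invariants and Strategy*, LNM 2270
  (2020), Thm. 1.2 (p. 5). [CossartJannsenSaito2020]
* J. Lipman, *Desingularization of two-dimensional schemes*, Ann. of Math. 107 (1978) 151–207
  (resolution of excellent surfaces by normalizations and point blow-ups).
* O. Zariski, *The reduction of the singularities of an algebraic surface*, Ann. of Math. 40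
  (1939) 639–689.
-/

noncomputable section

open CategoryTheory AlgebraicGeometry TopologicalSpace Topology

namespace Literature.AlgebraicGeometry.Resolution

universe u

/-! ## Dimension bookkeeping in `WithBot ℕ∞` -/

/-- In `WithBot ℕ∞` (the values of `topologicalKrullDim`), `d ≤ 2` means `d ≤ 1` or `d = 2`.
[folklore] -/
theorem le_one_or_eq_two_of_le_two {d : WithBot ℕ∞} (h : d ≤ 2) : d ≤ 1 ∨ d = 2 := by
  have h2 : d ≤ ((2 : ℕ∞) : WithBot ℕ∞) := h
  induction d using WithBot.recBotCoe with
  | bot => exact Or.inl bot_le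
  | coe a =>
    have ha : a ≤ (2 : ℕ∞) := WithBot.coe_le_coe.mp h2
    induction a using ENat.recTopCoe with
    | top => exact absurd (top_le_iff.mp ha) (by simp)
    | coe n =>
      have hn : n ≤ 2 := by exact_mod_cast ha
      rcases Nat.lt_or_ge n 2 with hlt | hge
      · have h1 : (n : ℕ∞) ≤ (1 : ℕ∞) := by exact_mod_cast (show n ≤ 1 by omega)
        exact Or.inl (WithBot.coe_le_coe.mpr h1)
      · obtain rfl : n = 2 := le_antisymm hn hge
        exact Or.inr rfl

/-! ## The normalization of a variety is birational -/

section Normalization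

variable (X : Scheme.{u}) [IsIntegral X] {k : Type u} [Field k]

/-- **The normalization of a variety is birational**: for an integral scheme `X` locally of
finite type over a field, `X^ν → X` is an isomorphism over a non-empty (hence dense) affine open
with integrally closed coordinate ring (finiteness of normalization, E. Noether), whose preimage
is dense in the integral scheme `X^ν`. [folklore] -/
theorem isBirational_normalizationι (f : X ⟶ Spec (.of k)) [LocallyOfFiniteType f] :
    IsBirational (normalizationι X) := by
  obtain ⟨W, hW, hWne, hic⟩ :=
    exists_isAffineOpen_isIntegrallyClosed X NoetherFiniteIntegralClosure_holds f
  refine ⟨W, W.2.dense hWne, ?_, isIso_normalizationι_morphismRestrict X hW hWne hic⟩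
  refine (normalizationι X ⁻¹ᵁ W).2.dense ?_
  obtain ⟨y, hy⟩ := (normalizationι X).denseRange.exists_mem_open W.2 hWne
  exact ⟨y, hy⟩

/-- **Resolutions descend along the normalization**: if the normalization `X^ν` of an integral
scheme `X` locally of finite type over a field has a resolution of singularities, so has `X`
(`X^ν → X` is finite, hence proper, and birational). [folklore] -/
theorem Scheme.HasResolution.of_normalization (f : X ⟶ Spec (.of k)) [LocallyOfFiniteType f]
    (h : Scheme.HasResolution (normalization X)) : Scheme.HasResolution X := by
  haveI : IsFinite (normalizationι X) :=
    isFinite_normalizationι X NoetherFiniteIntegralClosure_holds f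
  exact Scheme.HasResolution.of_isBirational (normalizationι X)
    (isBirational_normalizationι X f) h

/-- The normalization of an integral scheme locally of finite type over `k` has the same
(topological Krull) dimension. [folklore] -/
theorem topologicalKrullDim_normalization (f : X ⟶ Spec (.of k)) [LocallyOfFiniteType f] :
    topologicalKrullDim (normalization X) = topologicalKrullDim X :=
  IsAlteration.topologicalKrullDim_eq f
    (isAlteration_normalizationι X NoetherFiniteIntegralClosure_holds f)

end Normalization

/-! ## The reduction to normal integral surfaces -/

variable {k : Type u} [Field k]

/-- Weak resolution up to dimension `2` over `k` contains the normal-surface case: every integral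
normal separated `k`-scheme of finite type of dimension `2` has a resolution. [folklore] -/
theorem ResolutionOverUpToDim.normalSurfaces (h : ResolutionOverUpToDim k 2) :
    ∀ (X : Scheme.{u}) (f : X ⟶ Spec (.of k)),
      IsSeparated f → LocallyOfFiniteType f → QuasiCompact f → IsIntegral X →
        (∀ x : X, IsIntegrallyClosed (X.presheaf.stalk x)) →
          topologicalKrullDim X = 2 → Scheme.HasResolution X := by
  intro X f hsep hlft hqc hint _ hdim
  exact h X f hsep hlft hqc inferInstance (by rw [hdim]; exact_mod_cast le_rfl)

/-- **Reduction to normal surfaces** (the classical first step of Zariski 1939 and Lipman 1978: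
normalize first): over a field `k`, if every integral normal (all local rings
integrally closed) separated `k`-scheme of finite type of dimension exactly `2` has a resolution
of singularities, then so has every reduced separated `k`-scheme of finite type of dimension
`≤ 2` (`ResolutionOverUpToDim k 2`). Proof: reduce to integral `X`
(`IntegralResolutionOverUpToDim.resolutionOverUpToDim`); if `dim X ≤ 1`, normalize
(`hasResolution_of_dim_le_one`); if `dim X = 2`, pass to the normalization `X^ν` — integral,
normal, finite over `X` (so again separated and of finite type over `k`), of dimension `2` — and
descend along the proper birational `X^ν → X` (`Scheme.HasResolution.of_normalization`).
[folklore] -/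
theorem resolutionOverUpToDim_two_of_normalSurfaces
    (h : ∀ (X : Scheme.{u}) (f : X ⟶ Spec (.of k)),
      IsSeparated f → LocallyOfFiniteType f → QuasiCompact f → IsIntegral X →
        (∀ x : X, IsIntegrallyClosed (X.presheaf.stalk x)) →
          topologicalKrullDim X = 2 → Scheme.HasResolution X) :
    ResolutionOverUpToDim k 2 := by
  refine IntegralResolutionOverUpToDim.resolutionOverUpToDim fun X f hsep hlft hqc hint hdim => ?_
  haveI := hsep; haveI := hlft; haveI := hqc; haveI := hint
  rcases le_one_or_eq_two_of_le_two (by exact_mod_cast hdim) with h1 | h2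
  · exact hasResolution_of_dim_le_one X f h1
  · haveI : IsFinite (normalizationι X) :=
      isFinite_normalizationι X NoetherFiniteIntegralClosure_holds f
    refine Scheme.HasResolution.of_normalization X f ?_
    refine h (normalization X) (normalizationι X ≫ f) inferInstance inferInstance inferInstance
      inferInstance (isIntegrallyClosed_stalk_normalization X) ?_
    rw [topologicalKrullDim_normalization X f, h2]

/-- Over `k`, weak resolution up to dimension `2` is equivalent to the resolution of integral
normal surfaces of dimension `2`. [folklore] -/
theorem resolutionOverUpToDim_two_iff_normalSurfaces :
    ResolutionOverUpToDim k 2 ↔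
      ∀ (X : Scheme.{u}) (f : X ⟶ Spec (.of k)),
        IsSeparated f → LocallyOfFiniteType f → QuasiCompact f → IsIntegral X →
          (∀ x : X, IsIntegrallyClosed (X.presheaf.stalk x)) →
            topologicalKrullDim X = 2 → Scheme.HasResolution X :=
  ⟨ResolutionOverUpToDim.normalSurfaces, resolutionOverUpToDim_two_of_normalSurfaces⟩

/-- **`CossartJannsenSaito2020` from the resolution of normal surfaces**: if, over every field
`k`, every integral normal separated `k`-scheme of finite type of dimension `2` has a resolution
of singularities, then `CossartJannsenSaito2020` (weak resolution of reduced separated schemes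
of finite type of dimension `≤ 2` over every field) holds. [folklore] -/
theorem cossartJannsenSaito2020_of_normalSurfaces
    (h : ∀ (k : Type u) [Field k] (X : Scheme.{u}) (f : X ⟶ Spec (.of k)),
      IsSeparated f → LocallyOfFiniteType f → QuasiCompact f → IsIntegral X →
        (∀ x : X, IsIntegrallyClosed (X.presheaf.stalk x)) →
          topologicalKrullDim X = 2 → Scheme.HasResolution X) :
    CossartJannsenSaito2020.{u} :=
  fun k _ => resolutionOverUpToDim_two_of_normalSurfaces (h k)

/-- `CossartJannsenSaito2020` is equivalent to the resolution of integral normal surfaces of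
dimension `2` over every field (its residual content in this tree: curves, components and
normalization are handled unconditionally). [folklore] -/
theorem cossartJannsenSaito2020_iff_normalSurfaces :
    CossartJannsenSaito2020.{u} ↔
      ∀ (k : Type u) [Field k] (X : Scheme.{u}) (f : X ⟶ Spec (.of k)),
        IsSeparated f → LocallyOfFiniteType f → QuasiCompact f → IsIntegral X →
          (∀ x : X, IsIntegrallyClosed (X.presheaf.stalk x)) →
            topologicalKrullDim X = 2 → Scheme.HasResolution X :=
  ⟨fun h k _ => (h k).normalSurfaces, cossartJannsenSaito2020_of_normalSurfaces⟩

end Literature.AlgebraicGeometry.Resolution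

end
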